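import Summits.AtomisticToContinuum.FouriersLaw.Theorems.EmbeddedDrudeMourreDrudeDissolutionStubPolynomialStationarity
import Summits.AtomisticToContinuum.FouriersLaw.Theorems.EmbeddedDrudeMourreDrudeDissolutionStubPencilDerivationAlgebra
import Summits.AtomisticToContinuum.FouriersLaw.Theorems.EmbeddedDrudeMourreDrudeDissolutionStubHarmonicSteinMomentum
import Summits.AtomisticToContinuum.FouriersLaw.Theorems.EmbeddedDrudeMourreDrudeDissolutionStubHarmonicSteinLiouville
import Literature.MathematicalPhysics.KineticTheory.HarmonicChaosDecomposition
import Literature.MathematicalPhysics.KineticTheory.InfiniteChainInvariantStates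
import HarnessLib

/-!
# The Schwinger–Dyson identity of the harmonic thermal state
(helper file of stub `stub_harmonicStein` (K1) of line `gram-pencil-harmonic-chaos`, crux
`EmbeddedDrudeMourre.DrudeDissolution`, item stmt-AtomisticToContinuum-12593; `--supports` file,
closes nothing; registered helper theorem `harmonicStein_schwingerDyson`)

WHAT. For `ω₂ > 0`, `T > 0`, every shift-invariant DLR state `μ` of the harmonic chain
`pinnedChain ω₂ 0 0 γ` at temperature `T`, every site `x` and every finite family of linear local
observables `φ(fᵢ)` (`HarmonicChaos.linObs`), `Π = ∏ᵢ φ(fᵢ)`, `Eᵢ = ∫ ∏_{j ≠ i} φ(f_j) dμ`: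
* `integrable_of_mem_localPolynomials` — local polynomials are `μ`-integrable;
* `integral_snd_mul_prod_linObs` — STEIN ALONG THE MOMENTA, `∫ p_x Π dμ = T Σᵢ f_i^p(x) Eᵢ`;
* `integral_force_mul_prod_linObs` (= `harmonicStein_schwingerDyson`) — the SCHWINGER–DYSON
  IDENTITY `∫ F_x Π dμ = −T Σᵢ f_i^q(x) Eᵢ`.

HOW. The momenta: the helper `integral_snd_mul_prod_affine` (Gaussian integration by parts in `p_x`
conditionally on everything else — `p_x` is `N(0,T)` and independent of the rest by the one-site DLR
equation), linear observables being affine along the momentum lines. Schwinger–Dyson: stub S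
(`stub_polynomialStationarity`, `∫ 𝒜H dμ = 0` on local polynomials) for `H = p_x Π`, with
`𝒜(p_x Π) = F_x Π + p_x 𝒜Π` and `𝒜Π = Σᵢ (∏_{j≠i} φ_j) Ψᵢ`, `Ψᵢ = Σ_y (p_y f_i^q(y) + F_y f_i^p(y))`
(helper `liouvilleZ_prod_linObs`); then Stein along `p_x` for the products with one letter `Ψᵢ`
(affine along `p_x` with slope `f_i^q(x)` since the forces do not read the momenta,
`integral_snd_mul_prod_psi`), and S once more after swapping the double sum
(`Σ_{i≠j} ∫ (∏_{l≠i,j} φ_l) Ψᵢ = ∫ 𝒜 ∏_{l≠j} φ_l dμ = 0`, `sum_integral_prod_psi_eq_zero`).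
-/

noncomputable section

namespace Summit.AtomisticToContinuum.FouriersLaw.Theorems.DrudeDissolution.GramPencilHarmonicChaos

open MeasureTheory Filter Set Function Topology
open scoped NNReal
open Literature.MathematicalPhysics.KineticTheory
open Literature.MathematicalPhysics.KineticTheory.HeatConduction
open HarmonicChaos ProbabilityTheory

/-! ## Assembly, part 1: integrability, Stein along the momenta, the Schwinger–Dyson identity -/

section Assembly

/-- Pointwise products of local polynomials are local polynomials. [folklore] -/
theorem mul_mem_localPolynomials {g h : ChainConfig → ℝ} (hg : g ∈
    (Algebra.adjoin ℝ (Set.range (fun xc : ℤ × Bool => fun σ : ChainConfig => if xc.2 then (σ xc.1).2 else (σ xc.1).1)))) (hh : h ∈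
    (Algebra.adjoin ℝ (Set.range (fun xc : ℤ × Bool => fun σ : ChainConfig => if xc.2 then (σ xc.1).2 else (σ xc.1).1)))) :
    (fun σ => g σ * h σ) ∈ (Algebra.adjoin ℝ (Set.range (fun xc : ℤ × Bool => fun σ : ChainConfig => if xc.2 then (σ xc.1).2 else (σ xc.1).1))) :=
  mul_mem hg hh

/-- Finite products of local polynomials are local polynomials. [folklore] -/
theorem prod_mem_localPolynomials {ι : Type*} (u : Finset ι) (g : ι → ChainConfig → ℝ)
    (hg : ∀ i ∈ u, g i ∈
        (Algebra.adjoin ℝ (Set.range (fun xc : ℤ × Bool => fun σ : ChainConfig => if xc.2 then (σ xc.1).2 else (σ xc.1).1)))) : (fun σ => ∏ i ∈ u, g i σ) ∈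
        (Algebra.adjoin ℝ (Set.range (fun xc : ℤ × Bool => fun σ : ChainConfig => if xc.2 then (σ xc.1).2 else (σ xc.1).1))) := by
  have h : (fun σ : ChainConfig => ∏ i ∈ u, g i σ) = ∏ i ∈ u, g i := by
    funext σ; simp [Finset.prod_apply]
  rw [h]
  exact Subalgebra.prod_mem _ hg

/-- The Liouville letters `Σ_{y ∈ S} (p_y g^q_y + F_y g^p_y)` of the pinned chain are local
polynomials. [folklore] -/
theorem psi_mem_localPolynomials (ω₂ lam β γ : ℝ) (g : TestFn) (S : Finset ℤ) :
    (fun σ : ChainConfig => ∑ y ∈ S, ((σ y).2 * g.1 y + (pinnedChain ω₂ lam β γ).force σ y * g.2 y)) ∈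
        (Algebra.adjoin ℝ (Set.range (fun xc : ℤ × Bool => fun σ : ChainConfig => if xc.2 then (σ xc.1).2 else (σ xc.1).1))) := by
  set A := (Algebra.adjoin ℝ (Set.range (fun xc : ℤ × Bool => fun σ : ChainConfig => if xc.2 then (σ xc.1).2 else (σ xc.1).1))) with hA
  have h : (fun σ : ChainConfig => ∑ y ∈ S, ((σ y).2 * g.1 y + (pinnedChain ω₂ lam β γ).force σ y * g.2 y)) =
      ∑ y ∈ S, (g.1 y • (fun σ : ChainConfig => (σ y).2) +
        g.2 y • (fun σ : ChainConfig => (pinnedChain ω₂ lam β γ).force σ y)) := by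
    funext σ
    simp only [Finset.sum_apply, Pi.add_apply, Pi.smul_apply, smul_eq_mul]
    refine Finset.sum_congr rfl fun y _ => ?_
    ring
  rw [h]
  exact A.sum_mem fun y _ => A.add_mem (A.smul_mem (momentum_mem_localPolynomials y) _)
    (A.smul_mem (force_pinnedChain_mem_localPolynomials ω₂ lam β γ y) _)

/-- **The Liouville letters are affine along the momentum lines**:
`Ψ_g(σ[p_x ↦ t]) = Ψ_g(σ) + g^q_x (t − p_x)` (`x ∈ S`; the forces do not read the momenta). [folklore] -/
theorem psi_update_snd (P : OscillatorChain) (g : TestFn) (S : Finset ℤ) {x : ℤ} (hx : x ∈ S)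
    (σ : ChainConfig) (t : ℝ) :
    (∑ y ∈ S, ((update σ x ((σ x).1, t) y).2 * g.1 y + P.force (update σ x ((σ x).1, t)) y * g.2 y)) =
      (∑ y ∈ S, ((σ y).2 * g.1 y + P.force σ y * g.2 y)) + g.1 x * (t - (σ x).2) := by
  have h : ∀ y ∈ S, (update σ x ((σ x).1, t) y).2 * g.1 y + P.force (update σ x ((σ x).1, t)) y * g.2 y =
      ((σ y).2 * g.1 y + P.force σ y * g.2 y) + (if y = x then g.1 x * (t - (σ x).2) else 0) := by
    intro y _
    rw [force_update_snd]
    by_cases hy : y = x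
    · subst hy; simp; ring
    · rw [update_of_ne hy, if_neg hy, add_zero]
  rw [Finset.sum_congr rfl h, Finset.sum_add_distrib, Finset.sum_ite_eq' S x, if_pos hx]

variable {ω₂ γ T : ℝ} {μ : Measure ChainConfig}

/-- **Local polynomials are integrable** under a shift-invariant DLR state of the harmonic chain.
[folklore] -/
theorem integrable_of_mem_localPolynomials (hω : 0 < ω₂) (hT : 0 < T)
    (hμ : (pinnedChain ω₂ 0 0 γ).IsChainGibbsMeasure T μ) (hS : IsShiftInvariant μ)
    {H : ChainConfig → ℝ} (hH : H ∈
        (Algebra.adjoin ℝ (Set.range (fun xc : ℤ × Bool => fun σ : ChainConfig => if xc.2 then (σ xc.1).2 else (σ xc.1).1)))) : Integrable H μ := by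
  obtain ⟨hm, hk⟩ := measurable_and_integrable_pow_of_mem_polyObs γ hω le_rfl le_rfl hT hμ hS hH
  have h1 := hk 1
  simp only [pow_one] at h1
  exact h1.mono' hm.aestronglyMeasurable (Eventually.of_forall fun σ => le_of_eq (Real.norm_eq_abs _))

/-- **Stein's identity along a momentum for products of linear observables**:
`∫ p_x ∏ᵢ φ(fᵢ) dμ = T Σᵢ f_i^p(x) ∫ ∏_{j ≠ i} φ(f_j) dμ`. [cite: LanfordLebowitzLieb1977, §4 remark (ii)] -/
theorem integral_snd_mul_prod_linObs (hω : 0 < ω₂) (hT : 0 < T)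
    (hμ : (pinnedChain ω₂ 0 0 γ).IsChainGibbsMeasure T μ) (hS : IsShiftInvariant μ)
    (x : ℤ) {ι : Type} [DecidableEq ι] (u : Finset ι) (f : ι → TestFn) :
    ∫ σ, (σ x).2 * ∏ i ∈ u, linObs (f i) σ ∂μ =
      T * ∑ i ∈ u, (f i).2 x * ∫ σ, ∏ j ∈ u.erase i, linObs (f j) σ ∂μ := by
  have hU : Continuous (pinnedChain ω₂ 0 0 γ).U :=
    (OscillatorChain.contDiff_two_U_pinnedChain ω₂ 0 0 γ).continuous
  have hV : Continuous (pinnedChain ω₂ 0 0 γ).V :=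
    (OscillatorChain.contDiff_two_V_pinnedChain ω₂ 0 0 γ).continuous
  refine integral_snd_mul_prod_affine hU hV hT hμ x u (fun i => linObs (f i)) (fun i => (f i).2 x)
    ?_ ?_ ?_
  · intro i _ σ t
    rw [linObs_update]
    simp
  · exact integrable_of_mem_localPolynomials hω hT hμ hS
      (mul_mem_localPolynomials (momentum_mem_localPolynomials x) (prod_linObs_mem_localPolynomials u f))
  · intro i _
    exact integrable_of_mem_localPolynomials hω hT hμ hS (prod_linObs_mem_localPolynomials _ f)

/-- **Stein along `p_x` for a product with one Liouville letter.** For `i ∈ u`,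
`∫ p_x (∏_{j≠i} φ_j) Ψᵢ = T (f_i^q(x) ∫ ∏_{j≠i} φ_j + Σ_{j≠i} f_j^p(x) ∫ (∏_{l≠i,j} φ_l) Ψᵢ)`,
`Ψᵢ = Σ_y (p_y f_i^q(y) + F_y f_i^p(y))` (its slope along `p_x` is `f_i^q(x)`). [folklore] -/
theorem integral_snd_mul_prod_psi (hω : 0 < ω₂) (hT : 0 < T)
    (hμ : (pinnedChain ω₂ 0 0 γ).IsChainGibbsMeasure T μ) (hS : IsShiftInvariant μ)
    (x : ℤ) {ι : Type} [DecidableEq ι] (u : Finset ι) (f : ι → TestFn) (S : Finset ℤ)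
    (hx : x ∈ S) {i : ι} (hi : i ∈ u) :
    ∫ σ, (σ x).2 * ((∏ j ∈ u.erase i, linObs (f j) σ) *
      ∑ y ∈ S, ((σ y).2 * (f i).1 y + (pinnedChain ω₂ 0 0 γ).force σ y * (f i).2 y)) ∂μ =
      T * ((f i).1 x * ∫ σ, ∏ j ∈ u.erase i, linObs (f j) σ ∂μ +
        ∑ j ∈ u.erase i, (f j).2 x * ∫ σ, (∏ l ∈ (u.erase j).erase i, linObs (f l) σ) *
          ∑ y ∈ S, ((σ y).2 * (f i).1 y + (pinnedChain ω₂ 0 0 γ).force σ y * (f i).2 y) ∂μ) := by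
  have hU : Continuous (pinnedChain ω₂ 0 0 γ).U :=
    (OscillatorChain.contDiff_two_U_pinnedChain ω₂ 0 0 γ).continuous
  have hV : Continuous (pinnedChain ω₂ 0 0 γ).V :=
    (OscillatorChain.contDiff_two_V_pinnedChain ω₂ 0 0 γ).continuous
  -- the family with the letter in slot `i`
  let Ψ : ChainConfig → ℝ := fun σ =>
    ∑ y ∈ S, ((σ y).2 * (f i).1 y + (pinnedChain ω₂ 0 0 γ).force σ y * (f i).2 y)
  let G : ι → ChainConfig → ℝ := fun j => if j = i then Ψ else linObs (f j)
  let c : ι → ℝ := fun j => if j = i then (f i).1 x else (f j).2 x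
  have hGi : G i = Ψ := if_pos rfl
  have hGne : ∀ j, j ≠ i → G j = linObs (f j) := fun j hj => if_neg hj
  have hci : c i = (f i).1 x := if_pos rfl
  have hcne : ∀ j, j ≠ i → c j = (f j).2 x := fun j hj => if_neg hj
  have hΨmem : Ψ ∈
      (Algebra.adjoin ℝ (Set.range (fun xc : ℤ × Bool => fun σ : ChainConfig => if xc.2 then (σ xc.1).2 else (σ xc.1).1))) := psi_mem_localPolynomials ω₂ 0 0 γ (f i) S
  have hGmem : ∀ j, G j ∈ (Algebra.adjoin ℝ (Set.range (fun xc : ℤ × Bool => fun σ : ChainConfig => if xc.2 then (σ xc.1).2 else (σ xc.1).1))) := by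
    intro j
    by_cases hj : j = i
    · subst hj; rw [hGi]; exact hΨmem
    · rw [hGne j hj]; exact linObs_mem_localPolynomials (f j)
  -- products of the family
  have hprod_erase : ∀ (v : Finset ι), i ∉ v → ∀ σ, ∏ j ∈ v, G j σ = ∏ j ∈ v, linObs (f j) σ := by
    intro v hv σ
    refine Finset.prod_congr rfl fun j hj => ?_
    rw [hGne j (fun h => hv (h ▸ hj))]
  have hprod_with : ∀ (v : Finset ι), i ∈ v → ∀ σ,
      ∏ j ∈ v, G j σ = (∏ j ∈ v.erase i, linObs (f j) σ) * Ψ σ := by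
    intro v hv σ
    rw [← Finset.mul_prod_erase v (fun j => G j σ) hv, hGi, mul_comm,
      hprod_erase (v.erase i) (Finset.notMem_erase i v) σ]
  have haff : ∀ j ∈ u, ∀ (σ : ChainConfig) (t : ℝ),
      G j (update σ x ((σ x).1, t)) = G j σ + c j * (t - (σ x).2) := by
    intro j _ σ t
    by_cases hj : j = i
    · subst hj
      rw [hGi, hci]
      exact psi_update_snd _ (f j) S hx σ t
    · rw [hGne j hj, hcne j hj, linObs_update]
      simp
  have key := integral_snd_mul_prod_affine hU hV hT hμ x u G c haff
    (integrable_of_mem_localPolynomials hω hT hμ hS (mul_mem_localPolynomials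
      (momentum_mem_localPolynomials x) (prod_mem_localPolynomials u G fun j _ => hGmem j)))
    (fun j _ => integrable_of_mem_localPolynomials hω hT hμ hS
      (prod_mem_localPolynomials _ G fun l _ => hGmem l))
  simp_rw [hprod_with u hi] at key
  rw [key, ← Finset.add_sum_erase u _ hi, hci]
  congr 1
  congr 1
  · simp_rw [hprod_erase (u.erase i) (Finset.notMem_erase i u)]
  · refine Finset.sum_congr rfl fun j hj => ?_
    have hji : j ≠ i := Finset.ne_of_mem_erase hj
    have hiu : i ∈ u.erase j := Finset.mem_erase_of_ne_of_mem (Ne.symm hji) hi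
    rw [hcne j hji]
    simp_rw [hprod_with (u.erase j) hiu]
    rfl

/-- **`Σ_{i ∈ v} ∫ (∏_{l ≠ i} φ_l) Ψᵢ dμ = ∫ 𝒜 ∏_{l ∈ v} φ_l dμ = 0`** (generator stationarity of the
thermal state on local polynomials, stub S). [cite: LanfordLebowitzLieb1977, §4 remark (i)] -/
theorem sum_integral_prod_psi_eq_zero (hω : 0 < ω₂) (hT : 0 < T)
    (hμ : (pinnedChain ω₂ 0 0 γ).IsChainGibbsMeasure T μ) (hS : IsShiftInvariant μ)
    {ι : Type} [DecidableEq ι] (v : Finset ι) (f : ι → TestFn) (S : Finset ℤ)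
    (hSsub : ∀ i ∈ v, (f i).1.support ∪ (f i).2.support ⊆ S) :
    ∑ i ∈ v, ∫ σ, (∏ l ∈ v.erase i, linObs (f l) σ) *
      ∑ y ∈ S, ((σ y).2 * (f i).1 y + (pinnedChain ω₂ 0 0 γ).force σ y * (f i).2 y) ∂μ = 0 := by
  rw [← integral_finsetSum _ (fun i _ => integrable_of_mem_localPolynomials hω hT hμ hS
    (mul_mem_localPolynomials (prod_linObs_mem_localPolynomials _ f)
      (psi_mem_localPolynomials ω₂ 0 0 γ (f i) S)))]
  have h : (fun σ => ∑ i ∈ v, (∏ l ∈ v.erase i, linObs (f l) σ) *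
      ∑ y ∈ S, ((σ y).2 * (f i).1 y + (pinnedChain ω₂ 0 0 γ).force σ y * (f i).2 y)) =
      liouvilleZ (pinnedChain ω₂ 0 0 γ) (fun σ => ∏ i ∈ v, linObs (f i) σ) :=
    funext fun σ => (liouvilleZ_prod_linObs (pinnedChain ω₂ 0 0 γ) v f S hSsub σ).symm
  rw [h]
  exact (stub_polynomialStationarity ω₂ 0 0 γ T hω le_rfl le_rfl hT μ hμ hS _
    (prod_linObs_mem_localPolynomials v f)).2

/-- Swapping a double sum over off-diagonal pairs. [folklore] -/
theorem sum_sum_erase_comm {ι : Type*} [DecidableEq ι] (u : Finset ι) (a : ι → ι → ℝ) :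
    ∑ i ∈ u, ∑ j ∈ u.erase i, a i j = ∑ j ∈ u, ∑ i ∈ u.erase j, a i j := by
  have h1 : ∀ i ∈ u, ∑ j ∈ u.erase i, a i j = ∑ j ∈ u, if j ≠ i then a i j else 0 := by
    intro i _
    rw [← Finset.sum_filter, Finset.filter_ne']
  have h2 : ∀ j ∈ u, ∑ i ∈ u.erase j, a i j = ∑ i ∈ u, if j ≠ i then a i j else 0 := by
    intro j _
    rw [← Finset.sum_filter, Finset.filter_ne]
  rw [Finset.sum_congr rfl h1, Finset.sum_congr rfl h2, Finset.sum_comm]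

/-- **The Schwinger–Dyson identity of the harmonic thermal state**:
`∫ F_x ∏ᵢ φ(fᵢ) dμ = −T Σᵢ f_i^q(x) ∫ ∏_{j ≠ i} φ(f_j) dμ` — from `∫ 𝒜(p_x ∏ᵢ φ(fᵢ)) dμ = 0`,
`𝒜(p_x Π) = F_x Π + p_x 𝒜Π`, Stein along `p_x`, and `∫ 𝒜(∏_{l ≠ j} φ_l) dμ = 0` once more.
[cite: LanfordLebowitzLieb1977, §4 remarks (i)–(ii)] -/
theorem integral_force_mul_prod_linObs (hω : 0 < ω₂) (hT : 0 < T)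
    (hμ : (pinnedChain ω₂ 0 0 γ).IsChainGibbsMeasure T μ) (hS : IsShiftInvariant μ)
    (x : ℤ) {ι : Type} [DecidableEq ι] (u : Finset ι) (f : ι → TestFn) :
    ∫ σ, (pinnedChain ω₂ 0 0 γ).force σ x * ∏ i ∈ u, linObs (f i) σ ∂μ =
      -(T * ∑ i ∈ u, (f i).1 x * ∫ σ, ∏ j ∈ u.erase i, linObs (f j) σ ∂μ) := by
  set S : Finset ℤ := insert x (u.biUnion fun i => (f i).1.support ∪ (f i).2.support) with hSdef
  have hxS : x ∈ S := Finset.mem_insert_self _ _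
  have hSsub : ∀ i ∈ u, (f i).1.support ∪ (f i).2.support ⊆ S := fun i hi =>
    (Finset.subset_biUnion_of_mem (fun i => (f i).1.support ∪ (f i).2.support) hi).trans
      (Finset.subset_insert _ _)
  have hPi : (fun σ : ChainConfig => ∏ i ∈ u, linObs (f i) σ) ∈
      (Algebra.adjoin ℝ (Set.range (fun xc : ℤ × Bool => fun σ : ChainConfig => if xc.2 then (σ xc.1).2 else (σ xc.1).1))) := prod_linObs_mem_localPolynomials u f
  have hLPi : liouvilleZ (pinnedChain ω₂ 0 0 γ) (fun σ : ChainConfig => ∏ i ∈ u, linObs (f i) σ) ∈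
      (Algebra.adjoin ℝ (Set.range (fun xc : ℤ × Bool => fun σ : ChainConfig => if xc.2 then (σ xc.1).2 else (σ xc.1).1))) :=
    stub_pencilDerivation_algebra ω₂ 0 0 γ _ hPi
  have hpPi : (fun σ : ChainConfig => (σ x).2 * ∏ i ∈ u, linObs (f i) σ) ∈
      (Algebra.adjoin ℝ (Set.range (fun xc : ℤ × Bool => fun σ : ChainConfig => if xc.2 then (σ xc.1).2 else (σ xc.1).1))) :=
    mul_mem_localPolynomials (momentum_mem_localPolynomials x) hPi
  have hFPi : (fun σ : ChainConfig => (pinnedChain ω₂ 0 0 γ).force σ x * ∏ i ∈ u, linObs (f i) σ) ∈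
      (Algebra.adjoin ℝ (Set.range (fun xc : ℤ × Bool => fun σ : ChainConfig => if xc.2 then (σ xc.1).2 else (σ xc.1).1))) :=
    mul_mem_localPolynomials (force_pinnedChain_mem_localPolynomials ω₂ 0 0 γ x) hPi
  have hpLPi : (fun σ : ChainConfig => (σ x).2 *
      liouvilleZ (pinnedChain ω₂ 0 0 γ) (fun σ : ChainConfig => ∏ i ∈ u, linObs (f i) σ) σ) ∈
          (Algebra.adjoin ℝ (Set.range (fun xc : ℤ × Bool => fun σ : ChainConfig => if xc.2 then (σ xc.1).2 else (σ xc.1).1))) :=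
    mul_mem_localPolynomials (momentum_mem_localPolynomials x) hLPi
  -- Schwinger–Dyson: `0 = ∫ 𝒜(p_x Π) = ∫ F_x Π + ∫ p_x 𝒜Π`
  have h0 := (stub_polynomialStationarity ω₂ 0 0 γ T hω le_rfl le_rfl hT μ hμ hS _ hpPi).2
  have h1 : liouvilleZ (pinnedChain ω₂ 0 0 γ) (fun σ : ChainConfig => (σ x).2 * ∏ i ∈ u, linObs (f i) σ) =
      fun σ => (pinnedChain ω₂ 0 0 γ).force σ x * ∏ i ∈ u, linObs (f i) σ + (σ x).2 *
        liouvilleZ (pinnedChain ω₂ 0 0 γ) (fun σ : ChainConfig => ∏ i ∈ u, linObs (f i) σ) σ :=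
    funext fun σ => liouvilleZ_snd_mul_prod_linObs (pinnedChain ω₂ 0 0 γ) u f x S hxS hSsub σ
  rw [h1, integral_add (integrable_of_mem_localPolynomials hω hT hμ hS hFPi)
    (integrable_of_mem_localPolynomials hω hT hμ hS hpLPi)] at h0
  -- `∫ p_x 𝒜Π = T Σᵢ f_i^q(x) Eᵢ`
  have h2 : ∫ σ, (σ x).2 * liouvilleZ (pinnedChain ω₂ 0 0 γ)
      (fun σ : ChainConfig => ∏ i ∈ u, linObs (f i) σ) σ ∂μ =
      T * ∑ i ∈ u, (f i).1 x * ∫ σ, ∏ j ∈ u.erase i, linObs (f j) σ ∂μ := by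
    have hL : ∀ σ, (σ x).2 * liouvilleZ (pinnedChain ω₂ 0 0 γ)
        (fun σ : ChainConfig => ∏ i ∈ u, linObs (f i) σ) σ =
        ∑ i ∈ u, (σ x).2 * ((∏ j ∈ u.erase i, linObs (f j) σ) *
          ∑ y ∈ S, ((σ y).2 * (f i).1 y + (pinnedChain ω₂ 0 0 γ).force σ y * (f i).2 y)) := by
      intro σ
      rw [liouvilleZ_prod_linObs (pinnedChain ω₂ 0 0 γ) u f S hSsub σ, Finset.mul_sum]
    simp_rw [hL]
    rw [integral_finsetSum _ (fun i _ => integrable_of_mem_localPolynomials hω hT hμ hS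
      (mul_mem_localPolynomials (momentum_mem_localPolynomials x) (mul_mem_localPolynomials
        (prod_linObs_mem_localPolynomials _ f) (psi_mem_localPolynomials ω₂ 0 0 γ (f i) S))))]
    have h3 : ∀ i ∈ u, ∫ σ, (σ x).2 * ((∏ j ∈ u.erase i, linObs (f j) σ) *
        ∑ y ∈ S, ((σ y).2 * (f i).1 y + (pinnedChain ω₂ 0 0 γ).force σ y * (f i).2 y)) ∂μ =
        T * ((f i).1 x * ∫ σ, ∏ j ∈ u.erase i, linObs (f j) σ ∂μ) +
        T * ∑ j ∈ u.erase i, (f j).2 x * ∫ σ, (∏ l ∈ (u.erase j).erase i, linObs (f l) σ) *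
          ∑ y ∈ S, ((σ y).2 * (f i).1 y + (pinnedChain ω₂ 0 0 γ).force σ y * (f i).2 y) ∂μ := by
      intro i hi
      rw [integral_snd_mul_prod_psi hω hT hμ hS x u f S hxS hi, mul_add]
    rw [Finset.sum_congr rfl h3, Finset.sum_add_distrib, ← Finset.mul_sum, ← Finset.mul_sum]
    -- the second block vanishes after swapping the sums
    have h4 : ∑ i ∈ u, ∑ j ∈ u.erase i, (f j).2 x * ∫ σ, (∏ l ∈ (u.erase j).erase i, linObs (f l) σ) *
        ∑ y ∈ S, ((σ y).2 * (f i).1 y + (pinnedChain ω₂ 0 0 γ).force σ y * (f i).2 y) ∂μ = 0 := by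
      rw [sum_sum_erase_comm u (fun i j => (f j).2 x * ∫ σ, (∏ l ∈ (u.erase j).erase i, linObs (f l) σ) *
        ∑ y ∈ S, ((σ y).2 * (f i).1 y + (pinnedChain ω₂ 0 0 γ).force σ y * (f i).2 y) ∂μ)]
      refine Finset.sum_eq_zero fun j hj => ?_
      rw [← Finset.mul_sum, sum_integral_prod_psi_eq_zero hω hT hμ hS (u.erase j) f S
        (fun i hi => hSsub i (Finset.mem_of_mem_erase hi)), mul_zero]
    rw [h4, mul_zero, add_zero]
  rw [h2] at h0
  linarith

end Assembly

/-! ## The registered helper theorem -/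

/-- **Registered helper theorem of stub K1 (`stub_harmonicStein`): the Schwinger–Dyson identity of
the harmonic thermal state.** For `ω₂ > 0`, `T > 0`, every shift-invariant DLR state `μ` of
`pinnedChain ω₂ 0 0 γ` at `T`, every site `x` and linear observables `φ(fᵢ)`, `i ∈ u`:
`∫ F_x ∏ᵢ φ(fᵢ) dμ = −T Σᵢ f_i^q(x) ∫ ∏_{j ≠ i} φ(f_j) dμ`.
[cite: LanfordLebowitzLieb1977, §4 remarks (i)–(ii)] -/
theorem harmonicStein_schwingerDyson :
    ∀ (ω₂ γ T : ℝ), 0 < ω₂ → 0 < T → ∀ (μ : MeasureTheory.Measure ChainConfig),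
      (pinnedChain ω₂ 0 0 γ).IsChainGibbsMeasure T μ → IsShiftInvariant μ →
      ∀ (x : ℤ) {ι : Type} [DecidableEq ι] (u : Finset ι) (f : ι → TestFn),
        ∫ σ, (pinnedChain ω₂ 0 0 γ).force σ x * ∏ i ∈ u, linObs (f i) σ ∂μ =
          -(T * ∑ i ∈ u, (f i).1 x * ∫ σ, ∏ j ∈ u.erase i, linObs (f j) σ ∂μ) :=
  fun _ _ _ hω hT _ hμ hS x _ _ u f => integral_force_mul_prod_linObs hω hT hμ hS x u f

end Summit.AtomisticToContinuum.FouriersLaw.Theorems.DrudeDissolution.GramPencilHarmonicChaos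

end
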